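import Summits.BirchSwinnertonDyer.BirchSwinnertonDyer.Theorems.AdditiveKolyvaginRoadLowerHalfTwistOfKimStructure
import Literature.NumberTheory.EllipticCurves.Rank1Residual.PeriodUnitProofs
import HarnessLib

/-!
# Route `AdditiveKolyvaginRoad`, crux KS′ `LevelKolyvaginSystemsAdditive` (item stmt-BirchSwinnertonDyer-21396) ≡ KPA′ (21400):
# the Kurihara road's typed input `X4.KuriharaUnitAt` is RIGID AT THE BOTTOM LEVEL — on the rows with `Ш(E/ℚ)(p) = 0` it is
# EQUIVALENT to its instance `n = 1` («`δ̃₁ = [0]⁺_f = L(E,1)/Ω⁺_f` is a unit mod `p`»), and (with `p ∤ ∏ c_ℓ`) to Miller's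
# `BSD(E,p)` (cell `pub/bsd-wall`, width seat `bsd-wall-akr-p2x-w4` g10; sequel of p656066; `--supports stmt-BirchSwinnertonDyer-21396`)

THEOREMS ONLY (no definition, no named fact, no `sorry`).  BSD is not proved by any of this; KS′ and KPA′ stay OPEN at `p² ∣ N`;
Kim's theorem is NOT asserted (displayed hypothesis `hKim`, an EXISTING Literature named fact); Kurihara's conjecture is NOT asserted
(it is the tree's typed `@[conjecture]` predicate `Summit.BirchSwinnertonDyer.Rank1Residual.X4.KuriharaUnitAt`).

THE POINT (crux-ideate seat `cruxidea-…-21396-2` g22, 2026-08-28T18:45Z: «nothing asserted in Lean»).  The rank-`0` side of the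
Kurihara road to LOW₀ (w4 g6 `…LowerHalfTwistOfKuriharaRoad`, w4 g7 `…LowerHalfTwistOfKimStructure` = p656066) carries, for every
globally minimal Heegner-twist model `Wd`, the research input `X4.KuriharaUnitAt Wd p D.f`: «SOME mod-`p` Kurihara number `δ̃_n` at
SOME cyclic Kolyvagin level `n ∈ 𝒩₁` is a unit».  This file proves BY NAME that the existential over the level carries NO slack on
the rows the road serves:

* §1 `ratCast_zmod_ne_zero_iff` — arithmetic: `(x : ℤ/p) ≠ 0 ⟺ x ≠ 0 ∧ ord_p x = 0` (`x ∈ ℚ`, Mathlib's total field cast).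
* §2 «`n = 1` qualifies» (fact-free): `kuriharaNumber_one_ne_zero_iff` and `kuriharaUnitAt_of_ratCast_ratPlusSymbol_zero_ne_zero`
  — `1 ∈ 𝒩₁(E,p)` (`Kato.IsKolyvaginProduct.one`), the cyclicity ∕ discrete-logarithm clauses are vacuous, `δ̃₁ = \overline{[0]⁺_f}`
  (`kuriharaNumber_one`; Kim AJM 148 §1.4.3); so `[0]⁺_f ≢ 0 (mod p) ⟹ X4.KuriharaUnitAt W p f`.
* §3 `padicValRat_ratPlusSymbol_zero_eq_sha_of_kuriharaUnitAt` (conditional on `hKim` = Kim, Amer. J. Math. 148 (2026) Thm. 1.8 (6),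
  rank `0`, ANY reduction, named fact `Kim2022_rankZero_padicValRat_sha_of_kuriharaNumber_ne_zero_of_maninConstant`): at `p ≥ 5`,
  `ρ̄` onto, `L(E,1) ≠ 0`, `Ш` finite, Manin datum `p ∤ c`, period transfer `|u|_p = 1`, ANY unit cyclic level pins
  `ord_p [0]⁺_{D.f} = ord_p #Ш(E/ℚ)(p)` (Kim's `∂^{(0)}(δ̃) = length Ш[p^∞]` at the tree's `Ω⁺_f`-normalised symbol); hence
  `ratCast_ratPlusSymbol_zero_ne_zero_iff_sha_trivial_of_kuriharaUnitAt` («`[0]⁺` unit ⟺ `Ш(p) = 0`», granted one unit level).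
* §4 `kuriharaUnitAt_iff_ratCast_ratPlusSymbol_zero_ne_zero` — THE RIGIDITY on the `#Ш(E/ℚ)(p) = 1` rows:
  `X4.KuriharaUnitAt W p D.f ⟺ [0]⁺_{D.f} ≢ 0 (mod p)`.
* §5 `kuriharaUnitAt_of_bsdp` (FACT-FREE) and `kuriharaUnitAt_iff_bsdp` (`hKim` + GZK): on the `#Ш(p) = 1`, `p ∤ ∏ c_ℓ` rows
  Kurihara's typed conjecture IS Miller's `BSD(E,p)` (`⟹` = the X4 consumer `X4.bsdp_iff_not_dvd_tamagawaProduct_of_kim_rankZero`).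
* §6 `bsdp_twist_…` ∕ `lowerHalf_twist_of_ratCast_ratPlusSymbol_zero_ne_zero` — p656066's frame theorems with the clause
  `X4.KuriharaUnitAt Wd p D.f` of the twist supply `hTw` REPLACED by the bottom clause `[0]⁺_{D.f} ≢ 0 (mod p)` — the number a
  per-row certificate computes (`L(E^{(d_K)},1)/Ω⁺` mod `p`), nothing more.

READING (honest): on the `Ш(E^{(d_K)})(p) = 0` twist rows the road's research input is EXACTLY «`p ∤ [0]⁺_{f_d}`»; on rows with
`Ш(E^{(d_K)})(p) ≠ 0` the bottom number is NOT a unit (§3) and a unit lives at a level `ν(n) ≥ 1` — there the existential is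
genuine.  Conditional on every displayed binder; nothing is booked; the X4 cell's labels are unchanged; LOW₁ for `E` untouched.
References (locators only): [cite: Kim2022StructureSelmer, Thm. 1.9 (1), (6), Thm. 1.11 (1) (arXiv v4, PDF pp. 7–8); §1.4.3];
[cite: Kurihara2014, §1.1]; [cite: MazurTateTeitelbaum1986Invent, §I.8 (8.6)]; [cite: Miller2011LMS, Def. 1.1]; [cite: JetchevSkinnerWan2017, §7.4.1].
-/

-- single-conjunct summit: `Summit.BirchSwinnertonDyer.BirchSwinnertonDyer.…` repeats the name by design
set_option linter.dupNamespace false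
set_option autoImplicit false

noncomputable section

open scoped Classical

namespace Summit.BirchSwinnertonDyer.BirchSwinnertonDyer.Theorems.AdditiveKoly.KuriharaRoad

open WeierstrassCurve NumberField CongruenceSubgroup
  Literature.NumberTheory.EllipticCurves Literature.NumberTheory.EllipticCurves.ModularForms
  Literature.NumberTheory.EllipticCurves.Rank1Residual Literature.NumberTheory.EllipticCurves.Rank1Residual.Typed
  Summit.BirchSwinnertonDyer.Rank1Residual
  Summit.BirchSwinnertonDyer.BirchSwinnertonDyer.Theses.AdditiveKolyvaginRoad
  Summit.BirchSwinnertonDyer.BirchSwinnertonDyer.Theorems.AdditiveKolyvaginKernel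

open Literature.NumberTheory.DiophantineGeometry.Dioph (ratModP)

/-! ## §1 Arithmetic: a rational is a unit of `ℤ/p` iff it is a non-zero `p`-adic unit -/

/-- **`(x : ℤ/p) ≠ 0 ⟺ x ≠ 0 ∧ ord_p x = 0`** for `x ∈ ℚ`, `p` prime, `(x : ZMod p) = num x · (den x)⁻¹` Mathlib's total field
cast (`p ∣ den x` or `p ∣ num x` gives `0`; otherwise both are units of `ℤ/p`; `gcd(num, den) = 1`). [folklore] -/
theorem ratCast_zmod_ne_zero_iff {p : ℕ} [hp : Fact p.Prime] (x : ℚ) :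
    ((x : ℚ) : ZMod p) ≠ 0 ↔ x ≠ 0 ∧ padicValRat p x = 0 := by
  have hcast : ((x : ℚ) : ZMod p) = (x.num : ZMod p) * ((x.den : ZMod p))⁻¹ := by
    rw [Rat.cast_def, div_eq_mul_inv]
  have hv : padicValRat p x = (padicValNat p x.num.natAbs : ℤ) - (padicValNat p x.den : ℤ) := rfl
  -- `p` does not divide both `num x` and `den x`
  have hnot : ¬ (p ∣ x.num.natAbs ∧ p ∣ x.den) := fun h => by
    have hg := Nat.dvd_gcd h.1 h.2
    rw [x.reduced] at hg
    exact hp.out.one_lt.ne' (Nat.dvd_one.mp hg)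
  constructor
  · intro h
    have hnum : ¬ p ∣ x.num.natAbs := fun hd => h (by
      rw [hcast, (ZMod.intCast_zmod_eq_zero_iff_dvd x.num p).mpr (Int.natCast_dvd.mpr hd), zero_mul])
    have hden : ¬ p ∣ x.den := fun hd => h (by
      rw [hcast, (ZMod.natCast_eq_zero_iff x.den p).mpr hd, inv_zero, mul_zero])
    have hx0 : x ≠ 0 := by
      rintro rfl
      exact hnum (by simp)
    refine ⟨hx0, ?_⟩
    rw [hv, padicValNat.eq_zero_of_not_dvd hnum, padicValNat.eq_zero_of_not_dvd hden]
    simp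
  · rintro ⟨hx0, hval⟩
    have hnum0 : x.num.natAbs ≠ 0 := Int.natAbs_ne_zero.mpr (Rat.num_ne_zero.mpr hx0)
    have hnum : ¬ p ∣ x.num.natAbs := by
      intro hd
      have hden : ¬ p ∣ x.den := fun hd' => hnot ⟨hd, hd'⟩
      have h1 : 1 ≤ padicValNat p x.num.natAbs := one_le_padicValNat_of_dvd hnum0 hd
      rw [hv, padicValNat.eq_zero_of_not_dvd hden] at hval
      omega
    have hden : ¬ p ∣ x.den := by
      intro hd
      have h1 : 1 ≤ padicValNat p x.den := one_le_padicValNat_of_dvd x.den_pos.ne' hd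
      rw [hv, padicValNat.eq_zero_of_not_dvd hnum] at hval
      omega
    rw [hcast]
    refine mul_ne_zero ?_ (inv_ne_zero ?_)
    · rw [Ne, ZMod.intCast_zmod_eq_zero_iff_dvd]
      exact fun hd => hnum (Int.natCast_dvd.mp hd)
    · rw [Ne, ZMod.natCast_eq_zero_iff]
      exact hden

/-! ## §2 «`n = 1` qualifies»: the bottom Kurihara number and the typed input (fact-free) -/

/-- **`δ̃₁ ≢ 0 (mod p) ⟺ [0]⁺_f ≢ 0 (mod p)`**: at level `n = 1` the Kurihara number for the modulus `p = p¹` is the reduction of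
the single symbol `[0]⁺_f = L(f,1)/Ω⁺_f` (`kuriharaNumber_one`; Kim AJM 148 §1.4.3 «When `n = 1`, we have `δ̃₁ = [0]⁺ = L(E,1)/Ω⁺_E`»),
for every family `ψ` (none is used); at a prime modulus the reduction is the field cast (`ratModP_eq_ratCast`).
[cite: Kim2022StructureSelmer, §1.4.3 (arXiv v4, PDF p. 7)] [cite: Kurihara2014, §1.1] -/
theorem kuriharaNumber_one_ne_zero_iff {p : ℕ} [Fact p.Prime] {N : ℕ} [NeZero N] (f : CuspForm (Gamma0 N) 2)
    (ψ : (ℓ : ℕ) → (ZMod ℓ)ˣ →* Multiplicative (ZMod (p ^ 1))) :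
    kuriharaNumber f (p ^ 1) 1 ψ ≠ 0 ↔ ((ratPlusSymbol f 0 : ℚ) : ZMod p) ≠ 0 := by
  -- the modulus `p ^ 1` is `p`; generalise it away so that `ratModP_eq_ratCast` applies
  suffices h : ∀ (m : ℕ) (hm : m = p) (ψ' : (ℓ : ℕ) → (ZMod ℓ)ˣ →* Multiplicative (ZMod m)),
      kuriharaNumber f m 1 ψ' ≠ 0 ↔ ((ratPlusSymbol f 0 : ℚ) : ZMod p) ≠ 0 from h (p ^ 1) (pow_one p) ψ
  rintro m rfl ψ'
  rw [kuriharaNumber_one, ratModP_eq_ratCast]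

/-- **«`n = 1` QUALIFIES»: a unit bottom number is a unit Kurihara number at a cyclic Kolyvagin level** (fact-free).  If
`[0]⁺_f ≢ 0 (mod p)` then `X4.KuriharaUnitAt W p f` holds, witnessed at `n = 1`: `1 ∈ 𝒩₁(E,p)` (`Kato.IsKolyvaginProduct.one`, the empty
product), the cyclicity clause for the primes `ℓ ∣ 1` and the surjectivity clause for `ℓ ∈ primeFactors 1 = ∅` are vacuous, and
`δ̃₁ = \overline{[0]⁺_f}` (`kuriharaNumber_one_ne_zero_iff`).  By §4, on the `Ш(p) = 0` rows the converse holds too.  Nothing is asserted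
about Kurihara's conjecture itself. [cite: Kim2022StructureSelmer, §1.4.3 and Thm. 1.11 (1) (arXiv v4, PDF pp. 7–8)] [cite: Kurihara2014, §1.1] -/
theorem kuriharaUnitAt_of_ratCast_ratPlusSymbol_zero_ne_zero (W : WeierstrassCurve ℚ) [W.IsGloballyMinimal] (p : ℕ)
    [Fact p.Prime] {N : ℕ} [NeZero N] (f : CuspForm (Gamma0 N) 2) (h0 : ((ratPlusSymbol f 0 : ℚ) : ZMod p) ≠ 0) :
    X4.KuriharaUnitAt W p f := by
  refine ⟨1, inferInstance, Kato.IsKolyvaginProduct.one, ?_, fun _ => 1, ?_, ?_⟩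
  · intro ℓ hℓ hdvd
    exact absurd (Nat.eq_one_of_dvd_one hdvd) hℓ.out.one_lt.ne'
  · intro ℓ hℓ
    simp at hℓ
  · exact (kuriharaNumber_one_ne_zero_iff f _).mpr h0

variable (W : WeierstrassCurve ℚ) [W.IsElliptic] [W.IsGloballyMinimal] (p : ℕ) [hp : Fact p.Prime]

/-! ## §3 Kim's clause (6): ANY unit cyclic level pins `ord_p [0]⁺_f = ord_p #Ш(E/ℚ)(p)` -/

omit [W.IsGloballyMinimal] in
/-- **The bottom symbol against the Néron-normalised `L`-value.**  For a modular parametrisation datum `D` of `W` (newform `D.f`),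
`L(E,1) = [0]⁺_{D.f}·Ω⁺_{D.f}` (`IsNewformOf.entireLFunction_one_eq`, Manin–Drinfeld ∕ MTT §I.8), so under the period transfer
`Ω(W) = u·Ω⁺_{D.f}` (`u ∈ ℚ`, here only `Ω(W) > 0` is used to get `u ≠ 0`): if `L(E,1)/Ω(W) = q ∈ ℚ` then `[0]⁺_{D.f} = u·q`.
[cite: MazurTateTeitelbaum1986Invent, §I.8 (8.6)] -/
theorem ratPlusSymbol_zero_eq_mul_of_lvalue_div_realPeriod {N : ℕ} [NeZero N] (D : ModularParametrizationData W N)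
    {u : ℚ} (hΩ : W.realPeriodRat = u * plusPeriod D.f) {q : ℚ}
    (hq : W.entireLFunction 1 / (W.realPeriodRat : ℂ) = (q : ℂ)) : ratPlusSymbol D.f 0 = u * q := by
  have hΩpos : 0 < W.realPeriodRat := by
    haveI : (W.baseChange ℝ).IsElliptic := by rw [baseChange]; infer_instance
    exact (W.baseChange ℝ).realPeriod_pos'
  have hΩf : 0 < plusPeriod D.f := IsNewform0.plusPeriod_pos_holds D.isNewformOf.1 D.isNewformOf.coeffField_eq_bot
  have hΩC : (W.realPeriodRat : ℂ) ≠ 0 := by exact_mod_cast hΩpos.ne'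
  rw [div_eq_iff hΩC, D.isNewformOf.entireLFunction_one_eq, hΩ] at hq
  -- `[0]⁺ · Ω⁺ = q · (u · Ω⁺)` in `ℂ`, hence in `ℝ`, hence `[0]⁺ = q · u` in `ℚ`
  have hR : ((ratPlusSymbol D.f 0 : ℚ) : ℝ) * plusPeriod D.f = ((q * u : ℚ) : ℝ) * plusPeriod D.f := by
    have h1 : ((((ratPlusSymbol D.f 0 : ℚ) : ℝ) * plusPeriod D.f : ℝ) : ℂ) =
        ((((q * u : ℚ) : ℝ) * plusPeriod D.f : ℝ) : ℂ) := by
      rw [hq]; push_cast; ring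
    exact_mod_cast h1
  have h2 : ((ratPlusSymbol D.f 0 : ℚ) : ℝ) = ((q * u : ℚ) : ℝ) := mul_right_cancel₀ hΩf.ne' hR
  have h3 : ratPlusSymbol D.f 0 = q * u := by exact_mod_cast h2
  rw [h3, mul_comm]

omit [W.IsGloballyMinimal] in
/-- Valuation form of `ratPlusSymbol_zero_eq_mul_of_lvalue_div_realPeriod`: with `|u|_p = 1` and `L(E,1) ≠ 0`,
`[0]⁺_{D.f} ≠ 0` and `ord_p [0]⁺_{D.f} = ord_p q`. [cite: MazurTateTeitelbaum1986Invent, §I.8 (8.6)] -/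
theorem padicValRat_ratPlusSymbol_zero_eq_of_lvalue_div_realPeriod {N : ℕ} [NeZero N] (D : ModularParametrizationData W N)
    {u : ℚ} (hu : ‖(u : ℚ_[p])‖ = 1) (hΩ : W.realPeriodRat = u * plusPeriod D.f) (hL : W.entireLFunction 1 ≠ 0) {q : ℚ}
    (hq : W.entireLFunction 1 / (W.realPeriodRat : ℂ) = (q : ℂ)) :
    ratPlusSymbol D.f 0 ≠ 0 ∧ padicValRat p (ratPlusSymbol D.f 0) = padicValRat p q := by
  have hs := ratPlusSymbol_zero_eq_mul_of_lvalue_div_realPeriod W D hΩ hq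
  have hu0 : u ≠ 0 := by rintro rfl; simp at hu
  have hq0 : q ≠ 0 := by
    rintro rfl
    have hΩpos : 0 < W.realPeriodRat := by
      haveI : (W.baseChange ℝ).IsElliptic := by rw [baseChange]; infer_instance
      exact (W.baseChange ℝ).realPeriod_pos'
    have hΩC : (W.realPeriodRat : ℂ) ≠ 0 := by exact_mod_cast hΩpos.ne'
    rw [Rat.cast_zero, div_eq_zero_iff] at hq
    exact hq.elim hL hΩC
  refine ⟨by rw [hs]; exact mul_ne_zero hu0 hq0, ?_⟩
  rw [hs, padicValRat.mul hu0 hq0, padicValRat_eq_zero_of_norm_ratCast_eq_one hu, zero_add]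

/-- **ANY UNIT CYCLIC LEVEL PINS THE BOTTOM: `ord_p [0]⁺_f = ord_p #Ш(E/ℚ)(p)`** (Kim's `∂^{(0)}(δ̃) = length_{ℤ_p} Ш(E/ℚ)[p^∞]`, read
at the tree's `Ω⁺_f`-normalised symbol).  ASSUME Kim, Amer. J. Math. 148 (2026) Thm. 1.8 (6), analytic rank `0`, any reduction (named
fact `Kim2022_rankZero_padicValRat_sha_of_kuriharaNumber_ne_zero_of_maninConstant`, binder `hKim`).  `W/ℚ` globally minimal, `p ≥ 5`,
`ρ̄_{E,p}` onto, `L(E,1) ≠ 0`, `Ш(E/ℚ)` finite, `D` a modular parametrisation datum with `p ∤ D.maninConstant`, `Ω(W) = u·Ω⁺_{D.f}`,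
`|u|_p = 1`.  If `X4.KuriharaUnitAt W p D.f` (a unit mod-`p` Kurihara number at SOME cyclic level) then `[0]⁺_{D.f} ≠ 0` and
`ord_p [0]⁺_{D.f} = ord_p #Ш(E/ℚ)(p)` (`hKim`: `L(E,1)/Ω(W) = q`, `ord_p q = ord_p #Ш(p)`; and `[0]⁺ = u·q`).  Conditional on `hKim`.
[cite: Kim2022StructureSelmer, Thm. 1.9 (1), (6) (arXiv v4, PDF pp. 7–8); §1.5.1 (∂^{(0)} = ord_p δ̃₁)] -/
theorem padicValRat_ratPlusSymbol_zero_eq_sha_of_kuriharaUnitAt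
    (hKim : Kim2022_rankZero_padicValRat_sha_of_kuriharaNumber_ne_zero_of_maninConstant)
    (hp5 : 5 ≤ p) (hsurj : W.HasSurjectiveModNGaloisRep p) (hL : W.entireLFunction 1 ≠ 0) (hfin : Finite W.sha)
    {N : ℕ} [NeZero N] (D : ModularParametrizationData W N) (hc : ¬ (p : ℤ) ∣ D.maninConstant)
    {u : ℚ} (hu : ‖(u : ℚ_[p])‖ = 1) (hΩ : W.realPeriodRat = u * plusPeriod D.f) (hK : X4.KuriharaUnitAt W p D.f) :
    ratPlusSymbol D.f 0 ≠ 0 ∧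
      padicValRat p (ratPlusSymbol D.f 0) = (padicValNat p (Nat.card (AddCommGroup.primaryComponent W.sha p)) : ℤ) := by
  obtain ⟨n, hn0, hn, hcyc, ψ, hψ, hδ⟩ := hK
  obtain ⟨q, hq, hval⟩ := hKim W p hp5 hsurj hL hfin D hc ⟨u, hu, hΩ⟩ n hn hcyc ψ hψ hδ
  obtain ⟨hs0, hv⟩ := padicValRat_ratPlusSymbol_zero_eq_of_lvalue_div_realPeriod W p D hu hΩ hL hq
  exact ⟨hs0, hv.trans hval⟩

omit [W.IsElliptic] [W.IsGloballyMinimal] hp in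
/-- `#Ш(E/ℚ)(p)` is a power of `p` (a finite `p`-primary component), so `ord_p #Ш(E/ℚ)(p) = 0 ⟺ #Ш(E/ℚ)(p) = 1`. [folklore] -/
theorem padicValNat_card_sha_primaryComponent_eq_zero_iff [Fact p.Prime] [Finite W.sha] :
    padicValNat p (Nat.card (AddCommGroup.primaryComponent W.sha p)) = 0 ↔
      Nat.card (AddCommGroup.primaryComponent W.sha p) = 1 := by
  obtain ⟨m, hm⟩ := exists_card_addPrimaryComponent_eq_pow (A := W.sha) p
  rw [hm, padicValNat.prime_pow]
  exact ⟨fun h => by rw [h, pow_zero], fun h => Nat.pow_right_injective (Fact.out : p.Prime).two_le (h.trans (pow_zero p).symm)⟩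

/-- **Granted one unit level, the bottom is a unit iff `Ш(E/ℚ)(p) = 0`.**  Under the hypotheses of
`padicValRat_ratPlusSymbol_zero_eq_sha_of_kuriharaUnitAt` (incl. `hKim` and `X4.KuriharaUnitAt W p D.f`):
`[0]⁺_{D.f} ≢ 0 (mod p) ⟺ #Ш(E/ℚ)(p) = 1`.  In particular on a row with `Ш(E/ℚ)(p) ≠ 0` NO unit Kurihara number lives at the
bottom — the informative level has `ν(n) ≥ 1`.  Conditional on `hKim`; nothing is booked.
[cite: Kim2022StructureSelmer, Thm. 1.9 (6) (arXiv v4, PDF p. 8); §1.5.1] -/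
theorem ratCast_ratPlusSymbol_zero_ne_zero_iff_sha_trivial_of_kuriharaUnitAt
    (hKim : Kim2022_rankZero_padicValRat_sha_of_kuriharaNumber_ne_zero_of_maninConstant)
    (hp5 : 5 ≤ p) (hsurj : W.HasSurjectiveModNGaloisRep p) (hL : W.entireLFunction 1 ≠ 0) (hfin : Finite W.sha)
    {N : ℕ} [NeZero N] (D : ModularParametrizationData W N) (hc : ¬ (p : ℤ) ∣ D.maninConstant)
    {u : ℚ} (hu : ‖(u : ℚ_[p])‖ = 1) (hΩ : W.realPeriodRat = u * plusPeriod D.f) (hK : X4.KuriharaUnitAt W p D.f) :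
    ((ratPlusSymbol D.f 0 : ℚ) : ZMod p) ≠ 0 ↔ Nat.card (AddCommGroup.primaryComponent W.sha p) = 1 := by
  haveI : Finite W.sha := hfin
  obtain ⟨hs0, hv⟩ := padicValRat_ratPlusSymbol_zero_eq_sha_of_kuriharaUnitAt W p hKim hp5 hsurj hL hfin D hc hu hΩ hK
  rw [ratCast_zmod_ne_zero_iff, ← padicValNat_card_sha_primaryComponent_eq_zero_iff W p, hv]
  constructor
  · rintro ⟨-, h⟩
    exact_mod_cast h
  · intro h
    exact ⟨hs0, by exact_mod_cast h⟩

/-! ## §4 THE RIGIDITY on the `Ш(p) = 0` rows: the level-`n` existential ⟺ its instance `n = 1` -/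

/-- **KURIHARA BOTTOM-LEVEL RIGIDITY.**  ASSUME `hKim` (Kim AJM 148 Thm. 1.8 (6), rank `0`, any reduction; held named fact).  Let `W/ℚ`
be globally minimal, `p ≥ 5`, `ρ̄_{E,p}` onto, `L(E,1) ≠ 0`, `Ш(E/ℚ)` finite with `#Ш(E/ℚ)(p) = 1`, `D` a modular parametrisation
datum with `p ∤ D.maninConstant`, `Ω(W) = u·Ω⁺_{D.f}` with `|u|_p = 1`.  THEN the typed input of the Kurihara route — «a unit mod-`p`
Kurihara number at SOME cyclic Kolyvagin level», `X4.KuriharaUnitAt W p D.f` (Kim Thm. 1.10 (1) ∕ Kurihara's conjecture, a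
predicate) — is EQUIVALENT to its bottom instance «`[0]⁺_{D.f} = L(E,1)/Ω⁺ ≢ 0 (mod p)`»: `⟸` is «`n = 1` qualifies» (§2,
fact-free), `⟹` is §3.  So on these rows the existential over the level carries no slack: the research input is the mod-`p`
non-vanishing of ONE modular symbol.  Conditional on `hKim`; nothing is booked; Kurihara's conjecture is not asserted.
[cite: Kim2022StructureSelmer, Thm. 1.9 (1), (6) and Thm. 1.11 (1) (arXiv v4, PDF pp. 7–8); §1.4.3] [cite: Kurihara2014, §1.1] -/
theorem kuriharaUnitAt_iff_ratCast_ratPlusSymbol_zero_ne_zero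
    (hKim : Kim2022_rankZero_padicValRat_sha_of_kuriharaNumber_ne_zero_of_maninConstant)
    (hp5 : 5 ≤ p) (hsurj : W.HasSurjectiveModNGaloisRep p) (hL : W.entireLFunction 1 ≠ 0) (hfin : Finite W.sha)
    (hSha : Nat.card (AddCommGroup.primaryComponent W.sha p) = 1)
    {N : ℕ} [NeZero N] (D : ModularParametrizationData W N) (hc : ¬ (p : ℤ) ∣ D.maninConstant)
    {u : ℚ} (hu : ‖(u : ℚ_[p])‖ = 1) (hΩ : W.realPeriodRat = u * plusPeriod D.f) :
    X4.KuriharaUnitAt W p D.f ↔ ((ratPlusSymbol D.f 0 : ℚ) : ZMod p) ≠ 0 :=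
  ⟨fun hK => (ratCast_ratPlusSymbol_zero_ne_zero_iff_sha_trivial_of_kuriharaUnitAt W p hKim hp5 hsurj hL hfin D hc hu hΩ hK).mpr
      hSha,
    kuriharaUnitAt_of_ratCast_ratPlusSymbol_zero_ne_zero W p D.f⟩

/-! ## §5 On the `Ш(p) = 0`, `p ∤ ∏ c_ℓ` rows: Kurihara's typed conjecture ⟺ Miller's `BSD(E,p)` -/

omit [W.IsGloballyMinimal] in
/-- **`#Ш_an` in analytic rank `0` against the bottom symbol, any level.**  For a modular parametrisation datum `D` of `W`, the
period transfer `Ω(W) = u·Ω⁺_{D.f}` (`u ≠ 0`), `L(E,1) ≠ 0` and `rank E(ℚ) = 0` (so `Reg(E/ℚ) = 1`):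
`#Ш(E)_an = [0]⁺_{D.f}·#E(ℚ)_tors²/(u·∏ c_ℓ)` as a rational number (`L(E,1) = [0]⁺·Ω⁺`, `leadingLCoeff = L(E,1)`).
[cite: MazurTateTeitelbaum1986Invent, §I.8 (8.6)] [cite: Miller2011LMS, §1] -/
theorem shaAn_eq_ratPlusSymbol_zero_of_rank_zero {N : ℕ} [NeZero N] (D : ModularParametrizationData W N)
    {u : ℚ} (hu0 : u ≠ 0) (hΩ : W.realPeriodRat = u * plusPeriod D.f) (hL : W.entireLFunction 1 ≠ 0)
    (hmw0 : W.mordellWeilRank = 0) :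
    shaAn W = (((ratPlusSymbol D.f 0 : ℚ) * (W.torsionOrder : ℚ) ^ 2 / (u * (W.tamagawaProduct : ℚ)) : ℚ) : ℂ) := by
  have hr0 : W.analyticRank = 0 := analyticRank_eq_zero_of_entireLFunction_one_ne_zero hL
  have hR : W.regulator = 1 := W.regulator_eq_one_of_rank_zero hmw0
  have hΩf : 0 < plusPeriod D.f := IsNewform0.plusPeriod_pos_holds D.isNewformOf.1 D.isNewformOf.coeffField_eq_bot
  have hΩf' : ((plusPeriod D.f : ℝ) : ℂ) ≠ 0 := by exact_mod_cast hΩf.ne'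
  have hu' : ((u : ℝ) : ℂ) ≠ 0 := by exact_mod_cast hu0
  have hc0 : (W.tamagawaProduct : ℂ) ≠ 0 := by exact_mod_cast (W.tamagawaProduct_pos').ne'
  rw [shaAn_def, WeierstrassCurve.leadingLCoeff, hr0, iteratedDeriv_zero, Nat.factorial_zero, Nat.cast_one, div_one,
    D.isNewformOf.entireLFunction_one_eq, hR, hΩ]
  push_cast
  field_simp

/-- **`BSD(E,p)` ⟹ Kurihara's typed input, on the `Ш(p) = 0`, `p ∤ ∏ c_ℓ` rows — FACT-FREE** (no Kim, no Gross–Zagier–Kolyvagin).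
`W/ℚ` globally minimal, `E[p]` irreducible (so `p ∤ #E(ℚ)_tors`), `L(E,1) ≠ 0`, `#Ш(E/ℚ)(p) = 1`, `p ∤ ∏ c_ℓ(E)`, `D` a modular
parametrisation datum, `Ω(W) = u·Ω⁺_{D.f}` with `|u|_p = 1`.  If Miller's `BSD(E,p)` holds then `rank E(ℚ) = r_an = 0`,
`#Ш_an = [0]⁺·#tors²/(u·∏ c_ℓ) ∈ ℚ` has `ord_p #Ш_an = ord_p #Ш(p) = 0`, whence `ord_p [0]⁺_{D.f} = 0` and `X4.KuriharaUnitAt W p D.f` at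
`n = 1` (§2): wherever BSD is known on such a row, Kurihara's conjecture for the pair holds trivially at the bottom.  Nothing is booked.
[cite: Miller2011LMS, Def. 1.1] [cite: Kim2022StructureSelmer, §1.4.3] -/
theorem kuriharaUnitAt_of_bsdp (hirr : W.HasIrreducibleModPGaloisRep p) (hL : W.entireLFunction 1 ≠ 0)
    (hSha : Nat.card (AddCommGroup.primaryComponent W.sha p) = 1) (htam : ¬ p ∣ W.tamagawaProduct)
    {N : ℕ} [NeZero N] (D : ModularParametrizationData W N)
    {u : ℚ} (hu : ‖(u : ℚ_[p])‖ = 1) (hΩ : W.realPeriodRat = u * plusPeriod D.f) (hB : BSDp W p) :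
    X4.KuriharaUnitAt W p D.f := by
  obtain ⟨hmw, -, q, hq, hvq⟩ := hB
  have hr0 : W.analyticRank = 0 := analyticRank_eq_zero_of_entireLFunction_one_ne_zero hL
  have hmw0 : W.mordellWeilRank = 0 := by rw [hmw, hr0]
  have hu0 : u ≠ 0 := by rintro rfl; simp at hu
  have hs0 : ratPlusSymbol D.f 0 ≠ 0 := by
    intro h0
    apply hL
    rw [D.isNewformOf.entireLFunction_one_eq, h0]
    simp
  have ht0 : (W.torsionOrder : ℚ) ≠ 0 := by exact_mod_cast (W.torsionOrder_pos_holds).ne'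
  have hc0 : (W.tamagawaProduct : ℚ) ≠ 0 := by exact_mod_cast (W.tamagawaProduct_pos').ne'
  -- the witness `q` of `BSD(E,p)` IS `[0]⁺·#tors²/(u·∏c)`
  have hsha := shaAn_eq_ratPlusSymbol_zero_of_rank_zero W D hu0 hΩ hL hmw0
  rw [hq] at hsha
  have hqe : q = (ratPlusSymbol D.f 0 : ℚ) * (W.torsionOrder : ℚ) ^ 2 / (u * (W.tamagawaProduct : ℚ)) := by
    exact_mod_cast hsha
  -- valuations
  have hvT : padicValRat p (W.torsionOrder : ℚ) = 0 := by
    rw [padicValRat.of_nat]; exact_mod_cast padicValNat_torsionOrder_eq_zero_of_irreducible W p hirr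
  have hvc : padicValRat p (W.tamagawaProduct : ℚ) = 0 := by
    rw [padicValRat.of_nat]; exact_mod_cast padicValNat.eq_zero_of_not_dvd htam
  have hvu : padicValRat p u = 0 := padicValRat_eq_zero_of_norm_ratCast_eq_one hu
  have hvS : (padicValNat p (Nat.card (AddCommGroup.primaryComponent W.sha p)) : ℤ) = 0 := by rw [hSha]; simp
  have h2 : padicValRat p ((W.torsionOrder : ℚ) ^ 2) = 2 * padicValRat p (W.torsionOrder : ℚ) := by
    rw [pow_two, padicValRat.mul ht0 ht0]; ring
  rw [hqe, hvS, padicValRat.div (mul_ne_zero hs0 (pow_ne_zero 2 ht0)) (mul_ne_zero hu0 hc0),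
    padicValRat.mul hs0 (pow_ne_zero 2 ht0), h2, padicValRat.mul hu0 hc0, hvT, hvc, hvu] at hvq
  have hv0 : padicValRat p (ratPlusSymbol D.f 0) = 0 := by linarith
  exact kuriharaUnitAt_of_ratCast_ratPlusSymbol_zero_ne_zero W p D.f ((ratCast_zmod_ne_zero_iff _).mpr ⟨hs0, hv0⟩)

/-- **On the `Ш(p) = 0`, `p ∤ ∏ c_ℓ` rows, KURIHARA'S TYPED CONJECTURE ⟺ MILLER'S `BSD(E,p)`.**  ASSUME `hKim` (Kim AJM 148 Thm. 1.8
(6); held named fact) and Gross–Zagier–Kolyvagin `hGZK`.  `W/ℚ` globally minimal, `p ≥ 5`, `ρ̄_{E,p}` onto, `L(E,1) ≠ 0`, `#Ш(E/ℚ)(p) = 1`,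
`p ∤ ∏ c_ℓ(E)`, `D` a modular parametrisation datum with `p ∤ D.maninConstant`, `Ω(W) = u·Ω⁺_{D.f}`, `|u|_p = 1`.  THEN
`X4.KuriharaUnitAt W p D.f ⟺ BSDp W p`: `⟹` is the b2b-bsdres consumer `X4.bsdp_iff_not_dvd_tamagawaProduct_of_kim_rankZero` (per pair),
`⟸` is `kuriharaUnitAt_of_bsdp` (fact-free).  With §4: on these rows {Kurihara's conjecture, `[0]⁺ ≢ 0 (mod p)`, `BSD(E,p)`} are ONE
statement.  Conditional on `hKim`, `hGZK`; per pair; nothing is booked; no class label changes.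
[cite: Kim2022StructureSelmer, Thm. 1.9 (6), Thm. 1.11 (arXiv v4, PDF p. 8)] [cite: Miller2011LMS, Def. 1.1] -/
theorem kuriharaUnitAt_iff_bsdp
    (hKim : Kim2022_rankZero_padicValRat_sha_of_kuriharaNumber_ne_zero_of_maninConstant)
    (hGZK : rank_eq_analyticRank_of_analyticRank_le_one) (hp5 : 5 ≤ p) (hsurj : W.HasSurjectiveModNGaloisRep p)
    (hL : W.entireLFunction 1 ≠ 0) (hSha : Nat.card (AddCommGroup.primaryComponent W.sha p) = 1)
    (htam : ¬ p ∣ W.tamagawaProduct) {N : ℕ} [NeZero N] (D : ModularParametrizationData W N)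
    (hc : ¬ (p : ℤ) ∣ D.maninConstant) {u : ℚ} (hu : ‖(u : ℚ_[p])‖ = 1) (hΩ : W.realPeriodRat = u * plusPeriod D.f) :
    X4.KuriharaUnitAt W p D.f ↔ BSDp W p := by
  constructor
  · rintro ⟨n, hn0, hn, hcyc, ψ, hψ, hδ⟩
    exact (X4.bsdp_iff_not_dvd_tamagawaProduct_of_kim_rankZero W p hKim hGZK hp5 hsurj hL D hc ⟨u, hu, hΩ⟩ n hn hcyc ψ hψ
      hδ).mpr htam
  · exact kuriharaUnitAt_of_bsdp W p (hasIrreducibleModPGaloisRep_of_hasSurjectiveModNGaloisRep W p hsurj) hL hSha htam D hu hΩ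

/-! ## §6 The frame corollaries: p656066's twist supply with the Kurihara clause REPLACED by the bottom clause -/

/-- **`BSD_p` FOR THE HEEGNER TWIST FROM KIM'S STRUCTURE THEOREM AND A UNIT BOTTOM NUMBER `[0]⁺_{f_d} ≢ 0 (mod p)`** =
p656066's `bsdp_twist_of_kuriharaUnitAt` with the research clause `X4.KuriharaUnitAt Wd p D.f` of the twist supply `hTw` REPLACED by
the bottom clause `(([0]⁺_{D.f} : ℚ) : ℤ/p) ≠ 0` (the twist's unit `L`-value mod `p` in the `Ω⁺`-normalisation — the number a per-row
certificate computes), via «`n = 1` qualifies» (§2).  Frame: `E = W/ℚ` globally minimal, `p ≥ 5` additive, `ρ̄` onto, non-CM,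
`p ∤ ∏ c_ℓ(E)`; `K` imaginary quadratic, `d_K` odd, Heegner for `N_E`; `L(E^{(d_K)},1) ≠ 0`; `hmod`, `hGZK`, `hKim`.  Conclusion:
`BSDp Wd p` for every globally minimal `Wd = Cd • E^{(d_K)}`.  Conditional on every binder; nothing is booked.
[cite: Kim2022StructureSelmer, Thm. 1.9 (6) (arXiv v4, PDF p. 8); §1.4.3] [cite: JetchevSkinnerWan2017, §7.4.1] [cite: Miller2011LMS, Def. 1.1] -/
theorem bsdp_twist_of_ratCast_ratPlusSymbol_zero_ne_zero (K : Type) [Field K] [NumberField K]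
    (hKim : Kim2022_rankZero_padicValRat_sha_of_kuriharaNumber_ne_zero_of_maninConstant)
    (hGZK : rank_eq_analyticRank_of_analyticRank_le_one) (hmod : hasEntireLFunction_rat)
    (hp5 : 5 ≤ p) (hadd : Addv W p) (hs : W.HasSurjectiveModNGaloisRep p) (hCM : ¬ W.HasCM)
    (htam : ¬ p ∣ W.tamagawaProduct)
    (hK : IsImaginaryQuadratic K) (hodd : Odd (NumberField.discr K)) (hH : SatisfiesHeegnerHypothesis (W.conductorNorm ℤ) K)
    (hL : (W.quadraticTwist (NumberField.discr K : ℚ)).entireLFunction 1 ≠ 0)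
    (hTw : ∀ (Wd : WeierstrassCurve ℚ) [Wd.IsElliptic] [Wd.IsGloballyMinimal] (Cd : VariableChange ℚ),
      Cd • W.quadraticTwist (NumberField.discr K : ℚ) = Wd →
      ∃ (N : ℕ) (_ : NeZero N) (D : ModularParametrizationData Wd N),
        ¬ (p : ℤ) ∣ D.maninConstant ∧ (∃ u : ℚ, ‖(u : ℚ_[p])‖ = 1 ∧ Wd.realPeriodRat = u * plusPeriod D.f) ∧
          ((ratPlusSymbol D.f 0 : ℚ) : ZMod p) ≠ 0) :
    ∀ (Wd : WeierstrassCurve ℚ) [Wd.IsElliptic] [Wd.IsGloballyMinimal] (Cd : VariableChange ℚ),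
      Cd • W.quadraticTwist (NumberField.discr K : ℚ) = Wd → BSDp Wd p := by
  refine bsdp_twist_of_kuriharaUnitAt W p K hKim hGZK hmod hp5 hadd hs hCM htam hK hodd hH hL ?_
  intro Wd _ _ Cd hWd
  obtain ⟨N, hN, D, hc, hper, h0⟩ := hTw Wd Cd hWd
  exact ⟨N, hN, D, hc, hper, kuriharaUnitAt_of_ratCast_ratPlusSymbol_zero_ne_zero Wd p D.f h0⟩

/-- **LOW₀ FOR THE TWIST — the socket's binder `hlowTw` VERBATIM — from Kim's structure theorem and a unit bottom number.**  p656066's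
`lowerHalf_twist_of_kuriharaUnitAt` with the Kurihara clause of `hTw` REPLACED by `(([0]⁺_{D.f} : ℚ) : ℤ/p) ≠ 0`; conclusion
`Typed.MissingLowerBoundAt Wd p` for every globally minimal `Wd = Cd • E^{(d_K)}` — the shape consumed by
`exists_kolyvaginClass_ne_zero_of_lowerHalves` (p638284).  Conditional; nothing is booked.
[cite: Kim2022StructureSelmer, Thm. 1.9 (6) (arXiv v4, PDF p. 8)] [cite: Miller2011LMS, Def. 1.1] -/
theorem lowerHalf_twist_of_ratCast_ratPlusSymbol_zero_ne_zero (K : Type) [Field K] [NumberField K]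
    (hKim : Kim2022_rankZero_padicValRat_sha_of_kuriharaNumber_ne_zero_of_maninConstant)
    (hGZK : rank_eq_analyticRank_of_analyticRank_le_one) (hmod : hasEntireLFunction_rat)
    (hp5 : 5 ≤ p) (hadd : Addv W p) (hs : W.HasSurjectiveModNGaloisRep p) (hCM : ¬ W.HasCM)
    (htam : ¬ p ∣ W.tamagawaProduct)
    (hK : IsImaginaryQuadratic K) (hodd : Odd (NumberField.discr K)) (hH : SatisfiesHeegnerHypothesis (W.conductorNorm ℤ) K)
    (hL : (W.quadraticTwist (NumberField.discr K : ℚ)).entireLFunction 1 ≠ 0)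
    (hTw : ∀ (Wd : WeierstrassCurve ℚ) [Wd.IsElliptic] [Wd.IsGloballyMinimal] (Cd : VariableChange ℚ),
      Cd • W.quadraticTwist (NumberField.discr K : ℚ) = Wd →
      ∃ (N : ℕ) (_ : NeZero N) (D : ModularParametrizationData Wd N),
        ¬ (p : ℤ) ∣ D.maninConstant ∧ (∃ u : ℚ, ‖(u : ℚ_[p])‖ = 1 ∧ Wd.realPeriodRat = u * plusPeriod D.f) ∧
          ((ratPlusSymbol D.f 0 : ℚ) : ZMod p) ≠ 0) :
    ∀ (Wd : WeierstrassCurve ℚ) [Wd.IsElliptic] [Wd.IsGloballyMinimal] (Cd : VariableChange ℚ),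
      Cd • W.quadraticTwist (NumberField.discr K : ℚ) = Wd → MissingLowerBoundAt Wd p := by
  refine lowerHalf_twist_of_kuriharaUnitAt W p K hKim hGZK hmod hp5 hadd hs hCM htam hK hodd hH hL ?_
  intro Wd _ _ Cd hWd
  obtain ⟨N, hN, D, hc, hper, h0⟩ := hTw Wd Cd hWd
  exact ⟨N, hN, D, hc, hper, kuriharaUnitAt_of_ratCast_ratPlusSymbol_zero_ne_zero Wd p D.f h0⟩

end Summit.BirchSwinnertonDyer.BirchSwinnertonDyer.Theorems.AdditiveKoly.KuriharaRoad

end
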